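import Summits.ResolutionOfSingularities.ResolutionOfSingularities.Theorems.SharpStrataSepExcModelsKolchinPhase
import Summits.ResolutionOfSingularities.ResolutionOfSingularities.Theorems.SharpStrataSepExcModelsIsolatedCore
import Summits.ResolutionOfSingularities.ResolutionOfSingularities.Theorems.SharpStrataSepExcModelsRatAbhyankarModel
import Summits.ResolutionOfSingularities.ResolutionOfSingularities.Theorems.SharpStrataSepExcModelsRatAbhyankarPoint
import Summits.ResolutionOfSingularities.ResolutionOfSingularities.Theorems.SharpStrataSepExcModelsDvrPairValuation
import Summits.ResolutionOfSingularities.ResolutionOfSingularities.Theorems.SharpStrataSepExcModelsDvrFlagPoint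
import Summits.ResolutionOfSingularities.ResolutionOfSingularities.Theorems.SharpStrataSepExcModelsModelDescends
import Summits.ResolutionOfSingularities.ResolutionOfSingularities.Theorems.SharpStrataSepExcModelsSepAbhyankarModel
import Summits.ResolutionOfSingularities.ResolutionOfSingularities.Theorems.SharpStrataSepExcModelsModelValuation
import Summits.ResolutionOfSingularities.ResolutionOfSingularities.Theorems.SharpStrataSepExcModelsSepExcDescends
import Summits.ResolutionOfSingularities.ResolutionOfSingularities.Theorems.SharpStrataSepExcModelsSepAbhyankarPoint
import Summits.ResolutionOfSingularities.ResolutionOfSingularities.Theorems.SharpStrataSepExcModelsKolchinNoSharp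
import Summits.ResolutionOfSingularities.ResolutionOfSingularities.Theorems.SharpStrataSepExcModelsDimension
import Summits.ResolutionOfSingularities.ResolutionOfSingularities.Theorems.SharpStrataSepExcModelsSharpRelation
import Summits.ResolutionOfSingularities.ResolutionOfSingularities.Theorems.SharpStrataSepExcModelsSharpCertificate
import HarnessLib

/-!
# Crux `SepExcModels` (stmt-ResolutionOfSingularities-16828) — line `birth`, state after lead c1 (cycle 2, 2026-08-17)

Route `ResolutionOfSingularities/SharpStrata`, crux #2 (rank 2; open problem in print = Benito–Piltant–Reguera 2022,
Question 6.6 in separably-exceptional form). `SepExcModels` = every integral separated variety over a perfect field of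
characteristic `p` has a proper birational SEPARABLY EXCEPTIONAL model (every point regular, or closed, or carrying a
finitely generated birational local model with a regular prime over it whose quotient is generically smooth over the
residue field).

## The cut (unchanged since birth): the canonical KOLCHIN PHASE
Blow up the reduced closure of the sharp points, normalise, repeat (card `blunt-or-sharp-kolchin-models`, K1).
Vocabulary — TREE: `Theorems/SharpStrataSepExcModelsDefs.lean` (p154803): `SepExcAt`, `sharpLocus`, `sharpCentre`,
`IsKolchinStep`, `KVariety`, `KolchinRel` (and `Theorems.SharpStrata.SepExc`, verbatim the route's `let`).

## What is PROVED (all in the tree, sorry-free, axioms propext/Classical.choice/Quot.sound) — lead 0, cycle 1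
* `…SpecializationClosure.lean` (p148772), `…RegularOrClosedSpreads.lean` (p148661), `…ModelSpreads{Fibres,Avatars,}.lean`
  (p153024, p153667, p154280: PROPAGATION OF BLUNTNESS, BPR Lemma 4.2 / Prop. 2.1 in valuative dress),
  `…NormalizedBlowup.lean` (p148713), `…KolchinPhase.lean` (p155483: `isClosed_sharpCentre`, `exists_kolchinStep`,
  `sepExcModels_of_kolchinTerminates` — THE COMPOSITION), `…KolchinDimLeTwo.lean` (p156270: termination in dim ≤ 2).

## What is OPEN — one registered stub, crux-sized (handed back `promote-stub` by lead 0)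
* `stub_kolchinTerminates` : `Acc (KolchinRel k) V` for every variety over a perfect field of characteristic `p` =
  TERMINATION OF THE CANONICAL KOLCHIN PHASE = BPR Question 6.6 for the canonical process (printed open; BPR Prop. 6.7
  is birational-only for `p > (dim X)!`). First dimension with content: 3. Evidence: `Cruxes/SepExcModels/Ex57-falsifier.md`
  (the route's cheapest falsifier does NOT falsify: one step on the whole BPR Ex. 5.7 tower), `prank1-analysis.md`
  (dimension 3 ⟺ sub-question (Q) on p-rank-1 sharp points).

## NEW (lead c1, cycle 2): BLUNTNESS CERTIFICATES — six tool stubs, ALL LANDED (wave 1, 2026-08-17)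
Any proof of `stub_kolchinTerminates` must certify `SepExcAt` at the non-closed singular points of the successor
varieties; until now the tree could do so only by "regular", "closed", or an explicit chart computation. The tree
PROVES Knaf–Kuhlmann 2005 Thm. 1.1 (`KnafKuhlmann2005_Thm11_holds`; relative affine form over a perfect ground field:
`relLU_at_abhyankarPlace_of_perfectField`), which turns the third disjunct of `SepExcAt` into pure VALUATION THEORY.
Landed (all `--supports stmt-…-16828`, axioms propext/Classical.choice/Quot.sound): T1 p159610
`Theorems/SharpStrataSepExcModelsIsolatedCore.lean`; T2 ring p160505 `…RatAbhyankarModel.lean`; T2 scheme p162720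
`…RatAbhyankarPoint.lean`; T3 ring p162230 + p162399 `…DvrPairValuationComposite.lean`, `…DvrPairValuation.lean`;
T3 scheme p163047 `…DvrFlagPoint.lean`; T4 ring p164473 `…ModelDescends.lean`. Below each tool theorem is re-derived
from the tree by one `exact`, so this file's only `sorry` is `stub_kolchinTerminates`:
* (T2) `stub_model_of_ratAbhyankarPlace` (ring) / `stub_sepExcAt_of_ratAbhyankarPlace` (scheme) — an ABHYANKAR valuation
  ring of `K(Y)/k` dominating `𝒪_{Y,ζ}` with residue field `κ(ζ)` ("residually rational") makes `ζ` separably exceptional: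
  KK05 hands a finitely generated `k[t] ⊆ O_v` containing the affine coordinate ring, regular (even smooth) at the centre;
  `B := 𝒪_{Y,ζ}[t]`, `𝔮 := 𝔪_v ∩ B`, `B_𝔮 = k[t]_{centre}` (sandwich, `isRegularLocalRing_localization_of_sandwich`), and
  `B/𝔮 = κ(ζ)` by residual rationality, smooth over itself.
* (T3) `stub_ratAbhyankarPlace_of_dvrPair` (ring) / `stub_sepExcAt_of_dvrFlag` (scheme) — a DVR FLAG of length two at a
  point of codimension two (a generisation `w ⤳ ζ` with `𝒪_{Y,w}` a DVR — e.g. any prime divisor through `ζ` on a normal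
  `Y` — such that `cl{w}` is itself regular at `ζ`: `𝒪_{Y,ζ}/𝔭_w` a DVR) carries such a valuation: the composite
  `v = v_w ∘ v̄` of the two discrete valuations, rank 2, value group `ℤ²`, residue field `κ(ζ)`, Abhyankar. So on a normal
  3-fold a singular curve `C` is BLUNT as soon as ONE surface through `C` is regular along `C` — the certificate behind lead
  0's one-step computation on BPR Ex. 5.7 (`u`-chart), now uniform.
* (T4) `stub_model_descends` (ring) — bluntness DESCENDS along separable residue-field extensions under essentially
  finite-type birational local extensions (the dual of BPR's propagation): over a sharp `ζ`, every point `ζ'` of every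
  model with `κ(ζ')/κ(ζ)` separable is again sharp (non-regular and without a separable model) — a structural constraint
  on every step of the phase.
* (T1) `stub_sepExcModels_of_finiteSingularModels` — calibration: crux W of route IsolatedCore (stmt-18020,
  `IsolatedCore.FiniteSingularModels`: proper birational models regular off finitely many points) implies the crux
  outright (a point that is regular or closed is separably exceptional by the first two disjuncts).
Waves 2–3 and the lead added T2sep/T6 (the criterion made an equivalence), T4s (descent, scheme form), T7 (the `Iff` at a point,
p170109), T8 ((Q)-calibration of the open stub, p170283), T9 (dimension calibration of the crux modulo CossartPiltant2019,
p170736), and wave 4: N1/N1' (p171201, p171520) — a SHARPNESS certificate, with which the lead's explicit normal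
3-fold `t^p = z x^p + z² y^p + x^{p+1} + y^{p+1}` (`p ≥ 3`) is sharp along the `z`-axis: question (Q) is POSITIVE and
the `d = 3` hypothesis of T8 FAILS (`Cruxes/SepExcModels/Q-positive-sharp-3fold.md`; its Kolchin phase stops after one step). The composition `SepExcModels_proof` is unchanged; the tools are consumed by the open stub, not by the assembly.

History: birth skeleton by planner-skel-…-16828-0 (3 stubs); lead 0 reshaped to four tree-vocabulary stubs (all landed)
+ Defs + assembly + dim ≤ 2; lead c1 (this file): payload lines of the re-seat were ineligible (other cruxes, see
`Lines/payload-lines-ineligible-c1-dead.md`), `birth` continued, tool section added.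
Disproof used: none on file for this crux (`ledger crux ls`: no `Disproof.lean`; negatives: only `DefectlessFrames`).
-/

noncomputable section

-- single-problem summit: the doubled namespace component `ResolutionOfSingularities` is forced
set_option linter.dupNamespace false

open CategoryTheory AlgebraicGeometry TopologicalSpace Topology
open Literature.AlgebraicGeometry.Resolution
open Summit.ResolutionOfSingularities.ResolutionOfSingularities.Theses.SharpStrata (SepExcModels)
open Summit.ResolutionOfSingularities.ResolutionOfSingularities.Theorems.SepExcModels

namespace Summit.ResolutionOfSingularities.ResolutionOfSingularities.Cruxes.SepExcModels.Lines.Birth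

/-! ## The open stub and the composition (unchanged) -/

/-- **STUB (OPEN — the load-bearing one): the Kolchin phase terminates.** Every variety over a
perfect field of characteristic `p` is accessible for `KolchinRel k`: blowing up the reduced sharp
strata and normalising, repeatedly, reaches a variety without sharp points after finitely many
steps (BPR Question 6.6 for the canonical process; printed only birationally and only for
`p > (dim X)!`, Prop. 6.7; dimension ≤ 2: `acc_kolchinRel_of_topologicalKrullDim_le_two`).
[cite: BenitoPiltantReguera2022, Question 6.6, Prop. 6.7, Ex. 5.7] -/
theorem stub_kolchinTerminates (p : ℕ) (hp : p.Prime) (k : Type) [Field k] [CharP k p]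
    [PerfectField k] (V : KVariety k) : Acc (KolchinRel k) V := by
  sorry

/-- **The crux `SepExcModels`, assembled**: the tree theorem `sepExcModels_of_kolchinTerminates`
(`Theorems/SharpStrataSepExcModelsKolchinPhase.lean`, p155483) fed with the one open stub. The only
`sorry` in its closure is `stub_kolchinTerminates`. -/
theorem SepExcModels_proof : SepExcModels :=
  sepExcModels_of_kolchinTerminates stub_kolchinTerminates

/-! ## Bluntness certificates (tool stubs; all landed — re-derived from the tree)

(T1) calibration against route IsolatedCore. -/

/-- **TOOL, LANDED (T1, calibration): crux W of route `IsolatedCore` implies the crux.**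
`IsolatedCore.FiniteSingularModels` (stmt-18020) hands every integral separated finite-type `X`
over a field of characteristic `p` a proper birational integral model all of whose points are
regular or closed (`exists_model_regular_or_isClosed_of_finiteSingularModels`); such a point is
separably exceptional by the first two disjuncts of `SepExcAt`. [folklore] -/
theorem stub_sepExcModels_of_finiteSingularModels
    (hW : Theses.IsolatedCore.FiniteSingularModels) : Theses.SharpStrata.SepExcModels :=
  IsolatedCore.stub_sepExcModels_of_finiteSingularModels hW

/-! (T2) The valuative criterion: a residually rational Abhyankar valuation dominating the local ring. -/

/-- **TOOL, LANDED (T2, ring form): a residually rational Abhyankar place dominating `R = A_P` yields a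
separable regular birational local model.** Let `k` be perfect, `A` a finitely generated
`k`-algebra with fraction field `K`, `R = A_P`, and `O` a valuation ring of `K` containing `R`,
dominating it (`𝔪_R ⊆ 𝔪_O`), Abhyankar over (the image of) `k`, and residually rational over `R`
(every element of `O` is congruent to an element of `R` modulo `𝔪_O`). Then some
`B = R[s] ⊆ K` (`s` finite) has a prime `𝔮` over `𝔪_R` with `B_𝔮` regular and `(B/𝔮)[1/g]` smooth
over `κ(R)`. Proof route: Knaf–Kuhlmann 2005 Thm. 1.1 in the tree's relative affine form
(`relLU_at_abhyankarPlace_of_perfectField`, applied to the image of `A`) gives a finitely generated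
`N ⊇ A`, `N ⊆ O`, regular at the centre; take `s` = generators of `N`, `𝔮 = 𝔪_O ∩ R[s]`; then
`R[s]_𝔮 = N_{centre}` (`isRegularLocalRing_localization_of_sandwich`: `R ⊆ N_{centre}` because
denominators from `A ∖ P` are units of `O`), and `R[s]/𝔮 = κ(R)` by residual rationality, so `g = 1`.
[cite: KnafKuhlmann2005, Thm. 1.1] -/
theorem stub_model_of_ratAbhyankarPlace {k A K R : Type} [Field k] [PerfectField k]
    [CommRing A] [Algebra k A] [Algebra.FiniteType k A] [Field K] [Algebra k K] [Algebra A K]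
    [IsScalarTower k A K] [IsFractionRing A K] [CommRing R] [IsLocalRing R] [Algebra A R]
    [Algebra R K] [IsScalarTower A R K] (P : Ideal A) [P.IsPrime] [IsLocalization.AtPrime R P]
    (hfg : (⊤ : IntermediateField k K).FG)
    (O : ValuationSubring K) (hRO : ∀ r : R, algebraMap R K r ∈ O)
    (hdom : ∀ r ∈ IsLocalRing.maximalIdeal R, O.valuation (algebraMap R K r) < 1)
    (hAbh : IsAbhyankarPlace O (algebraMap k K).fieldRange ⊤)
    (hrat : ∀ x ∈ O, ∃ r : R, O.valuation (algebraMap R K r - x) < 1) :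
    ∃ (s : Finset K) (𝔮 : Ideal (Algebra.adjoin R (s : Set K))) (_ : 𝔮.IsPrime)
      (hle : IsLocalRing.maximalIdeal R ≤
        𝔮.comap (algebraMap R (Algebra.adjoin R (s : Set K)))),
      IsRegularLocalRing (Localization.AtPrime 𝔮) ∧
        ∃ g : Algebra.adjoin R (s : Set K), g ∉ 𝔮 ∧
          @Algebra.Smooth (R ⧸ IsLocalRing.maximalIdeal R) _
            (Localization.Away (Ideal.Quotient.mk 𝔮 g)) _
            ((algebraMap _ (Localization.Away (Ideal.Quotient.mk 𝔮 g))).comp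
              (Ideal.quotientMap 𝔮 (algebraMap R (Algebra.adjoin R (s : Set K))) hle)).toAlgebra :=
  RatAbhyankarModel.stub_model_of_ratAbhyankarPlace P hfg O hRO hdom hAbh hrat

/-- **TOOL, LANDED (T2, scheme form): a residually rational Abhyankar valuation centred at `ζ` makes `ζ`
separably exceptional.** For an integral `Y` locally of finite type over a perfect field `k`,
`ζ ∈ Y`, and a valuation ring `O` of `K(Y)` containing `𝒪_{Y,ζ}`, dominating it, Abhyankar over
`k` (w.r.t. `k → Γ(Spec k) → Γ(Y,⊤) → K(Y)`) and residually rational over `𝒪_{Y,ζ}`: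
`SepExcAt Y ζ`. Scheme dress of `stub_model_of_ratAbhyankarPlace` (affine chart `Spec A ∋ ζ`,
`𝒪_{Y,ζ} = A_P` inside `K(Y)` by `IsAffineOpen.isLocalization_stalk`, `K(Y)/k` finitely generated
by `essFiniteType_functionField`). [cite: KnafKuhlmann2005, Thm. 1.1] -/
theorem stub_sepExcAt_of_ratAbhyankarPlace (k : Type) [Field k] [PerfectField k]
    (Y : Scheme.{0}) [IsIntegral Y] (f : Y ⟶ Spec (.of k)) [LocallyOfFiniteType f] (ζ : Y)
    (O : ValuationSubring Y.functionField)
    (hRO : ∀ r : Y.presheaf.stalk ζ, algebraMap (Y.presheaf.stalk ζ) Y.functionField r ∈ O)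
    (hdom : ∀ r ∈ IsLocalRing.maximalIdeal (Y.presheaf.stalk ζ),
      O.valuation (algebraMap (Y.presheaf.stalk ζ) Y.functionField r) < 1)
    (hAbh : IsAbhyankarPlace O
      ((Y.presheaf.germ ⊤ (genericPoint Y) trivial).hom.comp
        (f.appTop.hom.comp (Scheme.ΓSpecIso (.of k)).inv.hom)).fieldRange ⊤)
    (hrat : ∀ x ∈ O, ∃ r : Y.presheaf.stalk ζ,
      O.valuation (algebraMap (Y.presheaf.stalk ζ) Y.functionField r - x) < 1) :
    SepExcAt Y ζ :=
  RatAbhyankarPoint.stub_sepExcAt_of_ratAbhyankarPlace k Y f ζ O hRO hdom hAbh hrat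

/-! (T3) DVR flags carry residually rational Abhyankar valuations. -/

/-- **TOOL, LANDED (T3, ring form): the composite of two discrete valuations is a residually rational
Abhyankar place.** Let `R` be a local domain with fraction field `K` over a field `k`, `P` a prime
of `R` such that `R_P` (`= W`) is a DVR and `R/P` is a DVR, `y₁,…,y_τ ∈ R` with residues
algebraically independent over `k`, and `tr.deg_k K ≤ τ + 2`. Then the COMPOSITE valuation ring
`O = {x ∈ W | x̄ ∈ R/P}` (`R/P` = the valuation ring of `κ(W) = Frac(R/P)`) contains `R`, dominates
it, is residually rational over `R`, and is an Abhyankar place of `K|k`: a uniformizer `π ∈ P` of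
`W` and a lift `t ∈ R` of a uniformizer of `R/P` have `ℤ`-independent values, the residues of the
`yⱼ` are algebraically independent over `k`, so `(π, t, y)` is algebraically independent
(`algebraicIndependent_sumElim_of_valuation`, Knaf–Kuhlmann 2005 Thm. 2.1) hence a transcendence
basis, and `K` is algebraic over `k(π, t, y)` (`isAbhyankarPlace_of_algebraic`).
[cite: KnafKuhlmann2005, Thm. 2.1; folklore (Zariski–Samuel II, VI §10, composite valuations)] -/
theorem stub_ratAbhyankarPlace_of_dvrPair {k K R W : Type} [Field k] [Field K] [Algebra k K]
    [CommRing R] [IsDomain R] [IsLocalRing R] [Algebra R K] [IsFractionRing R K]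
    [Algebra k R] [IsScalarTower k R K]
    (P : Ideal R) [P.IsPrime]
    [CommRing W] [IsDomain W] [IsDiscreteValuationRing W] [Algebra R W] [IsLocalization.AtPrime W P]
    (hD : IsDiscreteValuationRing (R ⧸ P))
    {τ : ℕ} (y : Fin τ → R)
    (hy : AlgebraicIndependent k fun j => IsLocalRing.residue R (y j))
    (htr : Algebra.trdeg k K ≤ (τ + 2 : ℕ)) :
    ∃ O : ValuationSubring K, (∀ r : R, algebraMap R K r ∈ O) ∧
      (∀ r ∈ IsLocalRing.maximalIdeal R, O.valuation (algebraMap R K r) < 1) ∧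
      IsAbhyankarPlace O (algebraMap k K).fieldRange ⊤ ∧
      ∀ x ∈ O, ∃ r : R, O.valuation (algebraMap R K r - x) < 1 :=
  DvrPairValuation.stub_ratAbhyankarPlace_of_dvrPair (W := W) P hD y hy htr

/-- **TOOL, LANDED (T3, scheme form): a point of codimension two with a DVR flag is separably
exceptional.** For an integral `Y` locally of finite type over a perfect field `k`, a generisation
`w ⤳ ζ` with `𝒪_{Y,w}` a DVR (on a normal `Y`: `w` the generic point of any prime divisor through
`ζ`) such that `cl{w}` is regular at `ζ` in codimension one (`𝒪_{Y,ζ}/𝔭_w` a DVR,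
`𝔭_w = (𝒪_{Y,ζ} → 𝒪_{Y,w})⁻¹ 𝔪_w`) and `dim 𝒪_{Y,ζ} ≤ 2`: `SepExcAt Y ζ`. Assembly of
`stub_ratAbhyankarPlace_of_dvrPair` (`𝒪_{Y,w}` is the localisation of `𝒪_{Y,ζ}` at `𝔭_w`,
`isLocalizationAtPrime_stalkSpecializes`; `y` lifts a transcendence basis of `κ(ζ)/k`;
`tr.deg_k K(Y) = dim Y = tr.deg_k κ(ζ) + dim 𝒪_{Y,ζ}`, `height_top_eq_trdeg`,
`height_eq_toENat_trdeg_residueField`, `coheight_add_height_eq_topologicalKrullDim`) and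
`stub_sepExcAt_of_ratAbhyankarPlace`. On a normal 3-fold: a singular curve is blunt at its generic
point as soon as one surface through it is regular along it. [cite: KnafKuhlmann2005, Thm. 1.1] -/
theorem stub_sepExcAt_of_dvrFlag (k : Type) [Field k] [PerfectField k]
    (Y : Scheme.{0}) [IsIntegral Y] (f : Y ⟶ Spec (.of k)) [LocallyOfFiniteType f] (ζ w : Y)
    (hw : w ⤳ ζ) (hW : IsDiscreteValuationRing (Y.presheaf.stalk w))
    (hD : IsDiscreteValuationRing (Y.presheaf.stalk ζ ⧸
      (IsLocalRing.maximalIdeal (Y.presheaf.stalk w)).comap (Y.presheaf.stalkSpecializes hw).hom))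
    (hdim : ringKrullDim (Y.presheaf.stalk ζ) ≤ 2) :
    SepExcAt Y ζ :=
  DvrFlagPoint.stub_sepExcAt_of_dvrFlag k Y f ζ w hw hW hD hdim

/-! (T4) Descent of bluntness along separable residue extensions. -/

/-- **TOOL, LANDED (T4, ring form): a separable regular model DESCENDS along an essentially finite-type
birational local extension with separable residue field extension.** Let `R ⊆ K` be local,
`R' = (R[c])_𝔭 ⊆ K` (`c` finite, `𝔭` over `𝔪_R`) with `κ(R')/κ(R)` formally smooth (= separable,
the extension being finitely generated), and let `R'` carry the third disjunct of `SepExcAt`: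
`B' = R'[s']`, `𝔮'` over `𝔪_{R'}`, `B'_{𝔮'}` regular, `(B'/𝔮')[1/g']` smooth over `κ(R')`. Then `R`
carries it too: `B := R[c ∪ s']`, `𝔮 := 𝔮' ∩ B`, `B_𝔮 = B'_{𝔮'}` (`B'` is a localisation of `B`,
`isLocalization_adjoin`), and `Frac(B/𝔮) = Frac(B'/𝔮')` is formally smooth over `κ(R')`, hence over
`κ(R)`, so the finitely generated `κ(R)`-domain `B/𝔮` is smooth on a non-empty open
(`isSmoothAt_bot_of_formallySmooth_fractionRing`, openness of the smooth locus). Contrapositive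
(with `π : Y' → Y` birational, `ζ' ↦ ζ`): over a SHARP `ζ` every `ζ'` with `κ(ζ')/κ(ζ)` separable is
sharp. [cite: BenitoPiltantReguera2022, Lemma 4.2 (dual statement); folklore] -/
theorem stub_model_descends {R K : Type} [CommRing R] [IsLocalRing R] [Field K] [Algebra R K]
    (c : Finset K) (𝔭 : Ideal (Algebra.adjoin R (c : Set K))) [𝔭.IsPrime]
    (R' : Type) [CommRing R'] [IsLocalRing R'] [Algebra (Algebra.adjoin R (c : Set K)) R']
    [IsLocalization.AtPrime R' 𝔭] [Algebra R' K]
    [IsScalarTower (Algebra.adjoin R (c : Set K)) R' K]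
    (hloc : IsLocalRing.maximalIdeal R ≤ (IsLocalRing.maximalIdeal R').comap
      ((algebraMap (Algebra.adjoin R (c : Set K)) R').comp
        (algebraMap R (Algebra.adjoin R (c : Set K)))))
    (hsep : @Algebra.FormallySmooth (R ⧸ IsLocalRing.maximalIdeal R)
      (R' ⧸ IsLocalRing.maximalIdeal R') _ _
      (Ideal.quotientMap (IsLocalRing.maximalIdeal R')
        ((algebraMap (Algebra.adjoin R (c : Set K)) R').comp
          (algebraMap R (Algebra.adjoin R (c : Set K)))) hloc).toAlgebra)
    (s' : Finset K) (𝔮' : Ideal (Algebra.adjoin R' (s' : Set K))) [𝔮'.IsPrime]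
    (hle' : IsLocalRing.maximalIdeal R' ≤
      𝔮'.comap (algebraMap R' (Algebra.adjoin R' (s' : Set K))))
    (hreg' : IsRegularLocalRing (Localization.AtPrime 𝔮'))
    (g' : Algebra.adjoin R' (s' : Set K)) (hg' : g' ∉ 𝔮')
    (hsm' : @Algebra.Smooth (R' ⧸ IsLocalRing.maximalIdeal R') _
      (Localization.Away (Ideal.Quotient.mk 𝔮' g')) _
      ((algebraMap _ (Localization.Away (Ideal.Quotient.mk 𝔮' g'))).comp
        (Ideal.quotientMap 𝔮' (algebraMap R' (Algebra.adjoin R' (s' : Set K))) hle')).toAlgebra) :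
    ∃ (s : Finset K) (𝔮 : Ideal (Algebra.adjoin R (s : Set K))) (_ : 𝔮.IsPrime)
      (hle : IsLocalRing.maximalIdeal R ≤
        𝔮.comap (algebraMap R (Algebra.adjoin R (s : Set K)))),
      IsRegularLocalRing (Localization.AtPrime 𝔮) ∧
        ∃ g : Algebra.adjoin R (s : Set K), g ∉ 𝔮 ∧
          @Algebra.Smooth (R ⧸ IsLocalRing.maximalIdeal R) _
            (Localization.Away (Ideal.Quotient.mk 𝔮 g)) _
            ((algebraMap _ (Localization.Away (Ideal.Quotient.mk 𝔮 g))).comp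
              (Ideal.quotientMap 𝔮 (algebraMap R (Algebra.adjoin R (s : Set K))) hle)).toAlgebra :=
  ModelDescends.stub_model_descends c 𝔭 R' hloc hsep s' 𝔮' hle' hreg' g' hg' hsm'

/-! ## Wave 2 tools (all LANDED: T2sep p165801, T6 p168685+p168689+p168690+p169368, T4s p166866+p167952): the criterion made NECESSARY AND SUFFICIENT, and descent in scheme form -/

/-- **TOOL, LANDED (T2sep, ring form): an Abhyankar place dominating `R = A_P` whose residue field is
FORMALLY SMOOTH (= separable; it is finitely generated by Knaf–Kuhlmann Cor. 2.2) over `κ(R)`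
yields a separable regular birational local model.** As `stub_model_of_ratAbhyankarPlace`, with
residual rationality weakened to separability of `κ(O)/κ(R)`: the model `N` of KK05 Thm 1.1 gives
`B = R[s]`, `𝔮`, `B_𝔮 = N_{centre}` regular (sandwich), and `Frac(B/𝔮) = κ(N_{centre})` is an
intermediate field of `κ(O)/κ(R)`, so it inherits MacLane's condition
(`linearIndepOn_pow_of_formallySmooth`), is separably generated (Mathlib
`exists_isTranscendenceBasis_and_isSeparable_of_linearIndepOn_pow_of_essFiniteType`), hence
formally smooth over `κ(R)`, and the finitely generated `κ(R)`-domain `B/𝔮` is smooth on a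
non-empty open (`isSmoothAt_bot_of_formallySmooth_fractionRing`). Covers the non-rational blunt
points (e.g. anisotropic quadric cones: the exceptional conic has no `κ`-point but a separable
function field). [cite: KnafKuhlmann2005, Thm. 1.1 and Cor. 2.2; Matsumura1987, Thm. 26.9] -/
theorem stub_model_of_sepAbhyankarPlace {k A K R : Type} [Field k] [PerfectField k]
    [CommRing A] [Algebra k A] [Algebra.FiniteType k A] [Field K] [Algebra k K] [Algebra A K]
    [IsScalarTower k A K] [IsFractionRing A K] [CommRing R] [IsLocalRing R] [Algebra A R]
    [Algebra R K] [IsScalarTower A R K] (P : Ideal A) [P.IsPrime] [IsLocalization.AtPrime R P]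
    (hfg : (⊤ : IntermediateField k K).FG)
    (O : ValuationSubring K) (φ : R →+* O) (hφ : ∀ r : R, (φ r : K) = algebraMap R K r)
    (hdom : IsLocalRing.maximalIdeal R ≤ (IsLocalRing.maximalIdeal O).comap φ)
    (hAbh : IsAbhyankarPlace O (algebraMap k K).fieldRange ⊤)
    (hsep : @Algebra.FormallySmooth (R ⧸ IsLocalRing.maximalIdeal R)
      (O ⧸ IsLocalRing.maximalIdeal O) _ _
      (Ideal.quotientMap (IsLocalRing.maximalIdeal O) φ hdom).toAlgebra) :
    ∃ (s : Finset K) (𝔮 : Ideal (Algebra.adjoin R (s : Set K))) (_ : 𝔮.IsPrime)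
      (hle : IsLocalRing.maximalIdeal R ≤
        𝔮.comap (algebraMap R (Algebra.adjoin R (s : Set K)))),
      IsRegularLocalRing (Localization.AtPrime 𝔮) ∧
        ∃ g : Algebra.adjoin R (s : Set K), g ∉ 𝔮 ∧
          @Algebra.Smooth (R ⧸ IsLocalRing.maximalIdeal R) _
            (Localization.Away (Ideal.Quotient.mk 𝔮 g)) _
            ((algebraMap _ (Localization.Away (Ideal.Quotient.mk 𝔮 g))).comp
              (Ideal.quotientMap 𝔮 (algebraMap R (Algebra.adjoin R (s : Set K))) hle)).toAlgebra :=
  SepAbhyankarModel.stub_model_of_sepAbhyankarPlace P hfg O φ hφ hdom hAbh hsep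

/-- **TOOL, LANDED (T6, ring form — the converse): a separable regular birational local model yields an
Abhyankar place dominating `R` with formally smooth residue field extension.** Given the third
disjunct of `SepExcAt` at `R = A_P` (`B = R[s]`, `𝔮` over `𝔪_R`, `B_𝔮` regular, `(B/𝔮)[1/g]`
smooth over `κ(R)`), the ORDER VALUATION of the regular local ring `B_𝔮` (the discrete valuation
ring `B_𝔮[𝔪/x]_{(x)}` of the first quadratic transform; trivial valuation if `𝔮 = ⊥`) dominates
`R`, is a prime divisor of `K/k` (hence Abhyankar: one value, `tr.deg − 1` independent residues),
and its residue field `κ(B_𝔮)(t₁,…,t_{d−1})` is purely transcendental over `Frac((B/𝔮)[1/g])`,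
which is formally smooth over `κ(R)`. With T2sep: **separably exceptional ⟺ valuatively blunt**
(some Abhyankar valuation centred at the point has formally smooth = separable residue field
extension) at every point of a variety over a perfect field. [cite: ZariskiSamuel1960II, VI §14
Thm. 31; KnafKuhlmann2005, Thm. 2.1] -/
theorem stub_sepAbhyankarPlace_of_model {k A K R : Type} [Field k]
    [CommRing A] [Algebra k A] [Algebra.FiniteType k A] [Field K] [Algebra k K] [Algebra A K]
    [IsScalarTower k A K] [IsFractionRing A K] [CommRing R] [IsLocalRing R] [Algebra A R]
    [Algebra R K] [IsScalarTower A R K] (P : Ideal A) [P.IsPrime] [IsLocalization.AtPrime R P]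
    (s : Finset K) (𝔮 : Ideal (Algebra.adjoin R (s : Set K))) [𝔮.IsPrime]
    (hle : IsLocalRing.maximalIdeal R ≤ 𝔮.comap (algebraMap R (Algebra.adjoin R (s : Set K))))
    (hreg : IsRegularLocalRing (Localization.AtPrime 𝔮))
    (g : Algebra.adjoin R (s : Set K)) (hg : g ∉ 𝔮)
    (hsm : @Algebra.Smooth (R ⧸ IsLocalRing.maximalIdeal R) _
      (Localization.Away (Ideal.Quotient.mk 𝔮 g)) _
      ((algebraMap _ (Localization.Away (Ideal.Quotient.mk 𝔮 g))).comp
        (Ideal.quotientMap 𝔮 (algebraMap R (Algebra.adjoin R (s : Set K))) hle)).toAlgebra) :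
    ∃ (O : ValuationSubring K) (φ : R →+* O) (_ : ∀ r : R, (φ r : K) = algebraMap R K r)
      (hdom : IsLocalRing.maximalIdeal R ≤ (IsLocalRing.maximalIdeal O).comap φ),
      IsAbhyankarPlace O (algebraMap k K).fieldRange ⊤ ∧
        @Algebra.FormallySmooth (R ⧸ IsLocalRing.maximalIdeal R)
          (O ⧸ IsLocalRing.maximalIdeal O) _ _
          (Ideal.quotientMap (IsLocalRing.maximalIdeal O) φ hdom).toAlgebra :=
  ModelValuation.stub_sepAbhyankarPlace_of_model P s 𝔮 hle hreg g hg hsm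

/-- **TOOL, LANDED (T4s, scheme form of descent): separable exceptionality descends along a proper
birational morphism at points with formally smooth residue field extension.** For `π : Y' → Y`
proper birational between integral schemes locally of finite type over a field and `ζ' ∈ Y'`
with `κ(ζ')/κ(π ζ')` formally smooth: `SepExcAt Y' ζ' → SepExcAt Y (π ζ')` (closed points go to
closed points under the proper `π`; a regular `𝒪_{Y',ζ'}` is itself a model, `s' = ∅`; the model
case is `stub_model_descends` after identifying `K(Y') = K(Y)`,
`IsBirational.isIso_stalkMap_genericPoint`, and presenting `𝒪_{Y',ζ'}` as a localisation of
`𝒪_{Y,ζ}[c]` through affine charts, `π` being locally of finite type). Contrapositive for the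
Kolchin phase: over a SHARP point, every point of the successor with separable residue field
extension is again sharp. [cite: BenitoPiltantReguera2022, Lemma 4.2 (dual statement); folklore] -/
theorem stub_sepExcAt_descends (k : Type) [Field k] (Y Y' : Scheme.{0}) [IsIntegral Y]
    [IsIntegral Y'] (f : Y ⟶ Spec (.of k)) [LocallyOfFiniteType f] (π : Y' ⟶ Y) [IsProper π]
    (hπ : IsBirational π) (ζ' : Y')
    (hsep : @Algebra.FormallySmooth (Y.residueField (π.base ζ')) (Y'.residueField ζ') _ _
      (π.residueFieldMap ζ').hom.toAlgebra)
    (h : SepExcAt Y' ζ') : SepExcAt Y (π.base ζ') :=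
  SepExcDescends.stub_sepExcAt_descends k Y Y' f π hπ ζ' hsep h

/-! ## Wave 3 tool (LANDED p170109): the criterion at a point of a variety, as one `Iff` -/

/-- **TOOL, LANDED (T7, scheme form — the criterion as an equivalence at a point).** For an integral `Y`
locally of finite type over a perfect field `k` and `ζ ∈ Y`: the third disjunct of `SepExcAt Y ζ`
(verbatim, with the `letI` algebra written as `@Algebra.Smooth … (…).toAlgebra`) holds IFF some
Abhyankar valuation ring `O` of `K(Y)/k` receives `𝒪_{Y,ζ}` (compatibly with `K(Y)`), dominates it,
and has residue field formally smooth (= separable; it is finitely generated) over `κ(ζ)`.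
Assembly of the landed ring theorems `SepAbhyankarModel.stub_model_of_sepAbhyankarPlace` (⟸) and
`ModelValuation.stub_sepAbhyankarPlace_of_model` (⟹) over an affine chart `Spec A ∋ ζ`
(`𝒪_{Y,ζ} = A_P` inside `K(Y)`: `IsAffineOpen.isLocalization_stalk`; `K(Y)/k` finitely generated),
exactly as `RatAbhyankarPoint.stub_sepExcAt_of_ratAbhyankarPlace` assembles the rational case.
This is "separably exceptional ⟺ valuatively blunt" (BPR's sharpness in Abhyankar form).
[cite: KnafKuhlmann2005, Thm. 1.1; ZariskiSamuel1960II, VI §14 Thm. 31] -/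
theorem stub_sepExcModel_iff_sepAbhyankarPlace (k : Type) [Field k] [PerfectField k]
    (Y : Scheme.{0}) [IsIntegral Y] (f : Y ⟶ Spec (.of k)) [LocallyOfFiniteType f] (ζ : Y) :
    (∃ (s : Finset Y.functionField)
        (𝔮 : Ideal (Algebra.adjoin (Y.presheaf.stalk ζ) (s : Set Y.functionField))) (_ : 𝔮.IsPrime)
        (hle : IsLocalRing.maximalIdeal (Y.presheaf.stalk ζ) ≤
          𝔮.comap (algebraMap (Y.presheaf.stalk ζ)
            (Algebra.adjoin (Y.presheaf.stalk ζ) (s : Set Y.functionField)))),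
        IsRegularLocalRing (Localization.AtPrime 𝔮) ∧
          ∃ g : Algebra.adjoin (Y.presheaf.stalk ζ) (s : Set Y.functionField), g ∉ 𝔮 ∧
            @Algebra.Smooth (Y.presheaf.stalk ζ ⧸ IsLocalRing.maximalIdeal (Y.presheaf.stalk ζ)) _
              (Localization.Away (Ideal.Quotient.mk 𝔮 g)) _
              ((algebraMap _ (Localization.Away (Ideal.Quotient.mk 𝔮 g))).comp
                (Ideal.quotientMap 𝔮 (algebraMap (Y.presheaf.stalk ζ)
                  (Algebra.adjoin (Y.presheaf.stalk ζ) (s : Set Y.functionField))) hle)).toAlgebra) ↔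
    ∃ (O : ValuationSubring Y.functionField) (φ : Y.presheaf.stalk ζ →+* O)
      (_ : ∀ r, (φ r : Y.functionField) = algebraMap (Y.presheaf.stalk ζ) Y.functionField r)
      (hdom : IsLocalRing.maximalIdeal (Y.presheaf.stalk ζ) ≤ (IsLocalRing.maximalIdeal O).comap φ),
      IsAbhyankarPlace O ((Y.presheaf.germ ⊤ (genericPoint Y) trivial).hom.comp
        (f.appTop.hom.comp (Scheme.ΓSpecIso (.of k)).inv.hom)).fieldRange ⊤ ∧
      @Algebra.FormallySmooth (Y.presheaf.stalk ζ ⧸ IsLocalRing.maximalIdeal (Y.presheaf.stalk ζ))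
        (O ⧸ IsLocalRing.maximalIdeal O) _ _
        (Ideal.quotientMap (IsLocalRing.maximalIdeal O) φ hdom).toAlgebra :=
  SepAbhyankarPoint.stub_sepExcModel_iff_sepAbhyankarPlace k Y f ζ

/-! ## Calibration of the open stub by question (Q) (T8, LANDED p170283) -/

/-- **TOOL, LANDED (T8): if normal varieties of dimension `≤ d` have no sharp point, the Kolchin
phase terminates in dimension `≤ d`** — for `d = 3` the hypothesis is a NEGATIVE answer to lead 0's
question (Q) (`Cruxes/SepExcModels/prank1-analysis.md`: sharp points of normal 3-folds are generic
points of curves with p-rank-1 residue field; do they exist?). A successor is normal of dimension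
`≤ d` (`KolchinNoSharp.normal_and_dim_le_of_kolchinRel`), hence has no sharp point, hence no
successor. The memo `bluntness-certificates.md` §5 argues (Q) is more likely POSITIVE, in which case
dimension 3 is the horizontal (finite modulo `Lipman1978ValuativeQuadraticSequence`) + vertical
(open) analysis of §3 instead. [cite: BenitoPiltantReguera2022, Question 6.6] -/
theorem stub_acc_kolchinRel_of_noSharpNormal (k : Type) [Field k] (d : WithBot ℕ∞)
    (hQ : ∀ W : KVariety k, (∀ y : W.X, IsIntegrallyClosed (W.X.presheaf.stalk y)) →
      topologicalKrullDim W.X ≤ d → sharpLocus W.X = ∅)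
    (V : KVariety k) (hV : topologicalKrullDim V.X ≤ d) : Acc (KolchinRel k) V :=
  KolchinNoSharp.stub_acc_kolchinRel_of_noSharpNormal k d hQ V hV

/-! ## Dimension calibration of the CRUX (T9, LANDED p170736): modulo `CossartPiltant2019` the crux starts in dimension 4 -/

/-- **TOOL, LANDED (T9): the crux `SepExcModels` is its dimension-`≥ 4` slice, modulo the named
fact `CossartPiltant2019`** — in dimension `≤ 3` ANY resolution is a separably exceptional model
(`Dimension.sepExcModels_dimLE_three`), so only fourfolds and up carry content for the crux; by
contrast the canonical Kolchin phase of THIS line has open content already in dimension 3 (T8 /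
memo §3): a dimension-3 failure of `stub_kolchinTerminates` would kill the line, not the crux.
[cite: CossartPiltant2019, Thm. 1.1] -/
theorem stub_sepExcModels_iff_dimGe4 (h : CossartPiltant2019.{0}) :
    Theses.SharpStrata.SepExcModels ↔
      ∀ p : ℕ, p.Prime → ∀ (k : Type) [Field k] [CharP k p] [PerfectField k] (X : Scheme.{0})
        [IsIntegral X] (f : X ⟶ Spec (.of k)), IsSeparated f → LocallyOfFiniteType f →
        QuasiCompact f → ¬ topologicalKrullDim X ≤ 3 →
        ∃ (X' : Scheme.{0}) (_ : IsIntegral X') (π : X' ⟶ X),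
          IsProper π ∧ IsBirational π ∧ Theorems.SharpStrata.SepExc X' :=
  Dimension.stub_sepExcModels_iff_dimGe4 h

/-! ## Wave 4 tools (LANDED: N1 p171201, N1' p171520): a SHARPNESS certificate — (Q) is positive

Hand proof and the explicit normal 3-fold `t^p = z x^p + z² y^p + x^{p+1} + y^{p+1}` (`p ≥ 3`, sharp along the
`z`-axis, Kolchin phase stops after ONE step): `Cruxes/SepExcModels/Q-positive-sharp-3fold.md`. -/

/-- **TOOL, LANDED (N1): the sharp relation forces `z^{1/p}` into every residue field.** In a valued field
of characteristic `p ≥ 3`: if `t^p = z x^p + z² y^p + e₁ x^p + e₂ y^p` with `x, y ≠ 0` and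
`x, y, e₁, e₂` of value `< 1` (and `z` in the valuation ring), then `z` is a `p`-th power in the
residue field. Proof: if `v(x) ≤ v(y)`, `u = t/x`, `b = y/x` give `ū^p = z̄ + z̄² b̄^p = (w + w²b̄)^p`,
so `w = z̄^{1/p}` is a root of `b̄T² + T − ū`, of degree ≤ 2 < p over the residue field unless it lies
in it (`X^p − a` is irreducible or has a root, prime degree); if `v(y) < v(x)`, `s = t/y` gives
`s̄^p = z̄²`, and `z̄ = (s̄^{(p+1)/2}/z̄)^p` (or `z̄ = 0`). [cite: BenitoPiltantReguera2022, Ex. 6.3 (method); folklore] -/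
theorem stub_residue_pthPower_of_sharpRelation {L : Type} [Field L] (p : ℕ) [Fact p.Prime]
    [CharP L p] (hp : 3 ≤ p) (z x y t e₁ e₂ : L)
    (hrel : t ^ p = z * x ^ p + z ^ 2 * y ^ p + e₁ * x ^ p + e₂ * y ^ p)
    (hx0 : x ≠ 0) (hy0 : y ≠ 0) (O : ValuationSubring L) (hzO : z ∈ O)
    (hx : O.valuation x < 1) (hy : O.valuation y < 1)
    (he₁ : O.valuation e₁ < 1) (he₂ : O.valuation e₂ < 1) :
    ∃ u : O, IsLocalRing.residue O u ^ p = IsLocalRing.residue O ⟨z, hzO⟩ :=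
  SharpRelation.stub_residue_pthPower_of_sharpRelation p hp z x y t e₁ e₂ hrel hx0 hy0 O hzO hx hy he₁ he₂

/-- **TOOL, LANDED (N1'): the SHARPNESS CERTIFICATE.** At `R = A_P` (finitely generated `A` over a field `k`,
inside `K = Frac A` of characteristic `p ≥ 3`): if `R` contains `z, x, y, t, e₁, e₂` with
`t^p = z x^p + z² y^p + e₁ x^p + e₂ y^p`, `x, y ≠ 0`, `x, y, e₁, e₂ ∈ 𝔪_R`, and the residue of `z` is
NOT a `p`-th power in `κ(R)`, then the third disjunct of `SepExcAt` FAILS at `R`: by T6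
(`ModelValuation.stub_sepAbhyankarPlace_of_model`) a model would give a valuation ring `O ⊇ R`
dominating it with `κ(O)/κ(R)` formally smooth, by N1 `z̄` becomes a `p`-th power `ū^p` in `κ(O)`,
and then `(1, ū)` is `κ(R)`-independent with `κ(R)`-dependent `p`-th powers `(1, z̄)` — MacLane's
condition, which formal smoothness implies (`linearIndepOn_pow_of_formallySmooth`), is violated.
Instance: the normal 3-fold `t^p = z x^p + z² y^p + x^{p+1} + y^{p+1}` over a perfect `k` is sharp
along the `z`-axis — question (Q) of `prank1-analysis.md` is POSITIVE and the `d = 3` hypothesis of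
T8 fails. [cite: BenitoPiltantReguera2022, Ex. 6.3 (method); Matsumura1987, Thm. 26.9] -/
theorem stub_not_model_of_sharpRelation {k A K R : Type} [Field k]
    [CommRing A] [Algebra k A] [Algebra.FiniteType k A] [Field K] [Algebra k K] [Algebra A K]
    [IsScalarTower k A K] [IsFractionRing A K] [CommRing R] [IsLocalRing R] [Algebra A R]
    [Algebra R K] [IsScalarTower A R K] (P : Ideal A) [P.IsPrime] [IsLocalization.AtPrime R P]
    (p : ℕ) [Fact p.Prime] [CharP K p] (hp : 3 ≤ p) (z x y t e₁ e₂ : R)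
    (hrel : t ^ p = z * x ^ p + z ^ 2 * y ^ p + e₁ * x ^ p + e₂ * y ^ p)
    (hx0 : algebraMap R K x ≠ 0) (hy0 : algebraMap R K y ≠ 0)
    (hx : x ∈ IsLocalRing.maximalIdeal R) (hy : y ∈ IsLocalRing.maximalIdeal R)
    (he₁ : e₁ ∈ IsLocalRing.maximalIdeal R) (he₂ : e₂ ∈ IsLocalRing.maximalIdeal R)
    (hz : ∀ r : R, IsLocalRing.residue R r ^ p ≠ IsLocalRing.residue R z) :
    ¬ ∃ (s : Finset K) (𝔮 : Ideal (Algebra.adjoin R (s : Set K))) (_ : 𝔮.IsPrime)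
      (hle : IsLocalRing.maximalIdeal R ≤ 𝔮.comap (algebraMap R (Algebra.adjoin R (s : Set K)))),
      IsRegularLocalRing (Localization.AtPrime 𝔮) ∧
        ∃ g : Algebra.adjoin R (s : Set K), g ∉ 𝔮 ∧
          @Algebra.Smooth (R ⧸ IsLocalRing.maximalIdeal R) _
            (Localization.Away (Ideal.Quotient.mk 𝔮 g)) _
            ((algebraMap _ (Localization.Away (Ideal.Quotient.mk 𝔮 g))).comp
              (Ideal.quotientMap 𝔮 (algebraMap R (Algebra.adjoin R (s : Set K))) hle)).toAlgebra :=
  SharpCertificate.stub_not_model_of_sharpRelation (k := k) P p hp z x y t e₁ e₂ hrel hx0 hy0 hx hy he₁ he₂ hz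

end Summit.ResolutionOfSingularities.ResolutionOfSingularities.Cruxes.SepExcModels.Lines.Birth

end
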